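import Literature.Analysis.SpecialFunctions.JacobiHeatSeries
import Literature.Analysis.SpecialFunctions.JacobiHeatPositivity
import Literature.Analysis.SpecialFunctions.HypergeometricPolynomialDensity
import Mathlib.MeasureTheory.Integral.DominatedConvergence
import HarnessLib

/-!
# Order properties of the Jacobi heat series with initial datum `z^{1-c}`

Topic `Literature/Analysis/SpecialFunctions` (generic). Sequel of `JacobiHeatSeries.lean`,
`JacobiHeatPositivity.lean` and `HypergeometricPolynomialDensity.lean`; motivation: the order
properties `0 ≤ h ≤ 1`, `h(θ, ·)` non-increasing, `h > 0` of the explicit solution of LSW's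
boundary problem behind `Literature.Probability.Percolation.LawlerSchrammWerner2002_hittingPDE`
(LSW (2002), Lemma 2.2, (2.2)), which in the variable `z = sin²(θ/4)` and after removing the
Dirichlet branch `z^{(c-1)}` (`c = 3/2 - 2/κ`) is `e^{-λ₀ t} Y(z, t)` with the Jacobi heat series
`Y` of the coefficients

  `γ_n = ⟨z^{1-c}, y_n⟩_ρ / h_n = (∫₀¹ (1-z)^{1-c} y_n) / h_n`  (the constant datum `1` in `θ`),

`λ₀ = μ(c-1)(2-c)`. For `1 < c < 2`, `μ > 0`, `t > 0`, `z ∈ (0, 1]` we prove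

  `1 ≤ Y(z, t)`,  `e^{-λ₀ t} Y(z, t) ≤ z^{1-c}`,  `t ↦ e^{-λ₀ t} Y(z, t)` non-increasing,

by **duality**: for a polynomial `p = Σ b_n y_n`, termwise integration (dominated convergence) and
orthogonality give `∫₀¹ ρ Y(·, t) p = ∫₀¹ (1-z)^{1-c} V_b(·, t)` with the polynomial heat flow `V_b`
(`jacobiHeatFin`), to which positivity preservation and the sub-Markov inequality of
`JacobiHeatPositivity.lean` apply; testing against squares `p = r²` and
`nonneg_of_forall_integral_mul_sq_nonneg` conclude. Bessel's bound `γ_n² h_n ≤ ∫₀¹ ρ z^{2-2c}`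
is Cauchy–Schwarz. No named fact is introduced.

## References

* G. F. Lawler, O. Schramm, W. Werner, *One-arm exponent for critical 2D percolation*, Electron.
  J. Probab. 7 (2002), no. 2, Lemma 2.2, (2.2). [LawlerSchrammWernerEJP2002]
* G. E. Andrews, R. Askey, R. Roy, *Special Functions*, CUP (1999), (2.5.14). [AndrewsAskeyRoy1999]
-/

noncomputable section

open Polynomial Set MeasureTheory intervalIntegral Filter
open scoped Topology

namespace Literature.Analysis.SpecialFunctions

/-! ### The coefficients of the initial datum `z^{1-c}` -/

/-- **The coefficients** `γ_n = (∫₀¹ (1-z)^{1-c} y_n(z) dz) / h_n = ⟨z^{1-c}, y_n⟩_ρ / ‖y_n‖²_ρ` of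
the initial datum `z^{1-c}` (the lift of the constant `1`). [folklore] -/
def jacobiInitCoeff (c : ℝ) (n : ℕ) : ℝ :=
  (∫ z in (0 : ℝ)..1, (1 - z) ^ (1 - c) * (hypJacobi c n).eval z) / hypJacobiNormSq c n

/-- The squared norm `B₀ = ∫₀¹ z^{1-c} (1-z)^{1-c} dz = ‖z^{1-c}‖²_ρ` of the initial datum. [folklore] -/
def jacobiInitNormSq (c : ℝ) : ℝ :=
  ∫ z in (0 : ℝ)..1, z ^ (1 - c) * (1 - z) ^ (1 - c)

section Init

variable {c : ℝ} (hc : 1 < c) (hc2 : c < 2)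
include hc hc2

/-- `z^{1-c} (1-z)^{1-c}` is integrable on `[0, 1]` (both exponents `> -1`). [folklore] -/
theorem intervalIntegrable_initNormSq :
    IntervalIntegrable (fun z : ℝ => z ^ (1 - c) * (1 - z) ^ (1 - c)) volume 0 1 := by
  have h1 : IntervalIntegrable (fun z : ℝ => z ^ (1 - c) * (1 - z) ^ (1 - c)) volume 0 (1 / 2) := by
    refine (intervalIntegral.intervalIntegrable_rpow' (r := 1 - c) (by linarith)).mul_continuousOn ?_
    refine ContinuousOn.rpow_const (by fun_prop) fun z hz => Or.inl ?_
    rw [uIcc_of_le (by norm_num : (0 : ℝ) ≤ 1 / 2)] at hz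
    linarith [hz.2]
  have h2 : IntervalIntegrable (fun z : ℝ => z ^ (1 - c) * (1 - z) ^ (1 - c)) volume (1 / 2) 1 := by
    have h : IntervalIntegrable (fun z : ℝ => (1 - z) ^ (1 - c)) volume (1 / 2) 1 := by
      refine (intervalIntegrable_one_sub_rpow hc2).mono_set ?_
      rw [uIcc_of_le (by norm_num : (1 : ℝ) / 2 ≤ 1), uIcc_of_le zero_le_one]
      exact Icc_subset_Icc (by norm_num) le_rfl
    refine h.continuousOn_mul ?_
    refine ContinuousOn.rpow_const (by fun_prop) fun z hz => Or.inl ?_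
    rw [uIcc_of_le (by norm_num : (1 : ℝ) / 2 ≤ 1)] at hz
    linarith [hz.1]
  exact h1.trans h2

omit hc hc2 in
/-- `B₀ ≥ 0`. [folklore] -/
theorem jacobiInitNormSq_nonneg : 0 ≤ jacobiInitNormSq c :=
  intervalIntegral.integral_nonneg zero_le_one fun z hz =>
    mul_nonneg (Real.rpow_nonneg hz.1 _) (Real.rpow_nonneg (by linarith [hz.2]) _)

/-- **Bessel/Cauchy–Schwarz**: `γ_n² h_n ≤ B₀`. [folklore] -/
theorem sq_jacobiInitCoeff_mul_le (n : ℕ) :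
    jacobiInitCoeff c n ^ 2 * hypJacobiNormSq c n ≤ jacobiInitNormSq c := by
  have hh := hypJacobiNormSq_pos hc hc2 n
  have hqc := continuous_hypJacobi_eval c n
  -- Cauchy–Schwarz with weight `ρ`, `f = z^{1-c}`, `g = y_n`
  have hCS := sq_integral_mul_mul_le zero_le_one (w := jacobiWeight c)
    (f := fun z : ℝ => z ^ (1 - c)) (g := fun z => (hypJacobi c n).eval z)
    (fun z hz => jacobiWeight_nonneg c hz) ?_ ?_ ?_
  rotate_left
  · refine (intervalIntegrable_initNormSq hc hc2).congr fun z hz => ?_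
    rw [uIoc_of_le zero_le_one] at hz
    show z ^ (1 - c) * (1 - z) ^ (1 - c) = (z ^ (1 - c)) ^ 2 * jacobiWeight c z
    rw [jacobiWeight, sq, mul_assoc, ← mul_assoc (z ^ (1 - c)) (z ^ (c - 1)),
      ← Real.rpow_add hz.1, show 1 - c + (c - 1) = 0 by ring, Real.rpow_zero, one_mul]
  · exact (intervalIntegrable_jacobiWeight_mul hc.le hc2 (hqc.pow 2)).congr fun z _ => by
      simp only [Pi.pow_apply]; ring
  · refine ((intervalIntegrable_one_sub_rpow hc2).mul_continuousOn hqc.continuousOn).congr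
      fun z hz => ?_
    rw [uIoc_of_le zero_le_one] at hz
    show (1 - z) ^ (1 - c) * (hypJacobi c n).eval z =
      z ^ (1 - c) * (hypJacobi c n).eval z * jacobiWeight c z
    rw [jacobiWeight, show z ^ (1 - c) * (hypJacobi c n).eval z * (z ^ (c - 1) * (1 - z) ^ (1 - c))
      = (z ^ (1 - c) * z ^ (c - 1)) * ((1 - z) ^ (1 - c) * (hypJacobi c n).eval z) by ring,
      ← Real.rpow_add hz.1, show 1 - c + (c - 1) = 0 by ring, Real.rpow_zero, one_mul]
  -- rewrite the three integrals
  have e1 : ∫ z in (0 : ℝ)..1, z ^ (1 - c) * (hypJacobi c n).eval z * jacobiWeight c z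
      = ∫ z in (0 : ℝ)..1, (1 - z) ^ (1 - c) * (hypJacobi c n).eval z := by
    refine intervalIntegral.integral_congr_ae (ae_of_all _ fun z hz => ?_)
    rw [uIoc_of_le zero_le_one] at hz
    rw [jacobiWeight, show z ^ (1 - c) * (hypJacobi c n).eval z * (z ^ (c - 1) * (1 - z) ^ (1 - c))
      = (z ^ (1 - c) * z ^ (c - 1)) * ((1 - z) ^ (1 - c) * (hypJacobi c n).eval z) by ring,
      ← Real.rpow_add hz.1, show 1 - c + (c - 1) = 0 by ring, Real.rpow_zero, one_mul]
  have e2 : ∫ z in (0 : ℝ)..1, (z ^ (1 - c)) ^ 2 * jacobiWeight c z = jacobiInitNormSq c := by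
    refine intervalIntegral.integral_congr_ae (ae_of_all _ fun z hz => ?_)
    rw [uIoc_of_le zero_le_one] at hz
    rw [jacobiWeight, sq, mul_assoc, ← mul_assoc (z ^ (1 - c)) (z ^ (c - 1)),
      ← Real.rpow_add hz.1, show 1 - c + (c - 1) = 0 by ring, Real.rpow_zero, one_mul]
  have e3 : ∫ z in (0 : ℝ)..1, ((hypJacobi c n).eval z) ^ 2 * jacobiWeight c z
      = hypJacobiNormSq c n := by
    unfold hypJacobiNormSq
    exact intervalIntegral.integral_congr fun z _ => by ring
  rw [e1, e2, e3] at hCS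
  -- `γ_n² h_n = (∫ (1-z)^{1-c} y_n)² / h_n ≤ B₀`
  unfold jacobiInitCoeff
  rw [div_pow, div_mul_eq_mul_div, sq (hypJacobiNormSq c n), mul_div_mul_right _ _ hh.ne',
    div_le_iff₀ hh]
  linarith

/-- The coefficient hypothesis of `JacobiHeatSeries` for `γ = jacobiInitCoeff c`, `G = B₀`. [folklore] -/
theorem init_hγ : ∀ n, jacobiInitCoeff c n ^ 2 * hypJacobiNormSq c n ≤ jacobiInitNormSq c :=
  fun n => sq_jacobiInitCoeff_mul_le hc hc2 n

/-- **Global termwise envelope**: there is `A` with `|γ_n y_n(z)| ≤ A (n+1) z^{(1-c)/2}` for all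
`n` and `z ∈ (0, 1]` (near-zero bound on `(0, 1/2]`, sup bound on `[1/2, 1]` where
`z^{(1-c)/2} ≥ 1`). [folklore] -/
theorem exists_envelope :
    ∃ A : ℝ, 0 ≤ A ∧ ∀ n : ℕ, ∀ z ∈ Ioc (0 : ℝ) 1,
      |jacobiInitCoeff c n * (hypJacobi c n).eval z| ≤ A * ((n : ℝ) + 1) * z ^ ((1 - c) / 2) := by
  obtain ⟨K₁, hK₁, h₁⟩ := exists_sq_hypJacobi_le_near_zero hc hc2
  obtain ⟨K₂, hK₂, h₂⟩ := exists_sq_hypJacobi_le hc hc2 (a := 1 / 2) (by norm_num) (by norm_num)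
  set G := jacobiInitNormSq c
  have hG : 0 ≤ G := jacobiInitNormSq_nonneg
  refine ⟨Real.sqrt (K₁ * G) + Real.sqrt (K₂ * G), by positivity, fun n z hz => ?_⟩
  have hzpow : 1 ≤ z ^ ((1 - c) / 2) :=
    Real.one_le_rpow_of_pos_of_le_one_of_nonpos hz.1 hz.2 (by linarith)
  have hzpos : 0 < z ^ ((1 - c) / 2) := Real.rpow_pos_of_pos hz.1 _
  rcases le_or_gt z (1 / 2) with hle | hgt
  · -- near zero
    have hsq : ((hypJacobi c n).eval z) ^ 2 ≤
        (K₁ * z ^ (1 - c)) * ((n : ℝ) + 1) ^ (2 * 1) * hypJacobiNormSq c n :=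
      (h₁ n z ⟨hz.1, hle⟩).trans_eq (by ring)
    have h := abs_coeff_mul_le hc hc2 (init_hγ hc hc2) n hsq
    have hsqrt : Real.sqrt (K₁ * z ^ (1 - c) * G) = Real.sqrt (K₁ * G) * z ^ ((1 - c) / 2) := by
      rw [show K₁ * z ^ (1 - c) * G = (K₁ * G) * z ^ (1 - c) by ring, Real.sqrt_mul (by positivity),
        Real.sqrt_eq_rpow (z ^ (1 - c)), ← Real.rpow_mul hz.1.le,
        show (1 - c) * (1 / 2) = (1 - c) / 2 by ring]
    rw [hsqrt, pow_one] at h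
    calc _ ≤ Real.sqrt (K₁ * G) * z ^ ((1 - c) / 2) * ((n : ℝ) + 1) := h
      _ ≤ (Real.sqrt (K₁ * G) + Real.sqrt (K₂ * G)) * ((n : ℝ) + 1) * z ^ ((1 - c) / 2) := by
          have : 0 ≤ Real.sqrt (K₂ * G) * ((n : ℝ) + 1) * z ^ ((1 - c) / 2) := by positivity
          nlinarith
  · -- on `[1/2, 1]`
    have hsq : ((hypJacobi c n).eval z) ^ 2 ≤ K₂ * ((n : ℝ) + 1) ^ (2 * 1) * hypJacobiNormSq c n :=
      (h₂ n z ⟨hgt.le, hz.2⟩).trans_eq (by ring)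
    have h := abs_coeff_mul_le hc hc2 (init_hγ hc hc2) n hsq
    rw [pow_one] at h
    calc _ ≤ Real.sqrt (K₂ * G) * ((n : ℝ) + 1) := h
      _ ≤ Real.sqrt (K₂ * G) * ((n : ℝ) + 1) * z ^ ((1 - c) / 2) :=
          le_mul_of_one_le_right (by positivity) hzpow
      _ ≤ (Real.sqrt (K₁ * G) + Real.sqrt (K₂ * G)) * ((n : ℝ) + 1) * z ^ ((1 - c) / 2) := by
          have : 0 ≤ Real.sqrt (K₁ * G) * ((n : ℝ) + 1) * z ^ ((1 - c) / 2) := by positivity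
          nlinarith

/-- `γ_n h_n = ∫₀¹ (1-z)^{1-c} y_n`. [folklore] -/
theorem jacobiInitCoeff_mul_normSq (n : ℕ) :
    jacobiInitCoeff c n * hypJacobiNormSq c n
      = ∫ z in (0 : ℝ)..1, (1 - z) ^ (1 - c) * (hypJacobi c n).eval z := by
  unfold jacobiInitCoeff
  rw [div_mul_cancel₀ _ (hypJacobiNormSq_pos hc hc2 n).ne']

end Init

/-! ### Duality: `∫₀¹ ρ Y(·,t) p = ∫₀¹ (1-z)^{1-c} V_b(·,t)` -/

section Duality

variable {c μ : ℝ} (hc : 1 < c) (hc2 : c < 2) (hμ : 0 < μ)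
include hc hc2 hμ

/-- The Jacobi heat series of the initial datum `z^{1-c}`. [folklore] -/
abbrev initHeat (c μ : ℝ) (z t : ℝ) : ℝ := jacobiHeat c μ (jacobiInitCoeff c) z t

omit hc hc2 in
/-- The envelope for the terms of `Y(·, t)`: `|γ_n e^{-μ_n t} y_n(z)| ≤ A (n+1) r^n z^{(1-c)/2}`,
`r = e^{-μ t}`. [folklore] -/
theorem abs_term_le_envelope {A : ℝ}
    (hA : ∀ n : ℕ, ∀ z ∈ Ioc (0 : ℝ) 1,
      |jacobiInitCoeff c n * (hypJacobi c n).eval z| ≤ A * ((n : ℝ) + 1) * z ^ ((1 - c) / 2))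
    (n : ℕ) {z t : ℝ} (hz : z ∈ Ioc (0 : ℝ) 1) (ht : 0 < t) :
    |jacobiHeatTerm c μ (jacobiInitCoeff c) n z t| ≤
      A * ((n : ℝ) + 1) * Real.exp (-(μ * t)) ^ n * z ^ ((1 - c) / 2) := by
  have h1 := hA n z hz
  have h2 := exp_heat_le hμ.le ht.le le_rfl n
  have h3 : 0 ≤ Real.exp (-(μ * n * (n + 1) * t)) := (Real.exp_pos _).le
  have hA0 : 0 ≤ A * ((n : ℝ) + 1) * z ^ ((1 - c) / 2) := (abs_nonneg _).trans h1
  rw [jacobiHeatTerm, show jacobiInitCoeff c n * Real.exp (-(μ * n * (n + 1) * t))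
    * (hypJacobi c n).eval z = (jacobiInitCoeff c n * (hypJacobi c n).eval z)
    * Real.exp (-(μ * n * (n + 1) * t)) by ring, abs_mul, abs_of_nonneg h3]
  calc _ ≤ (A * ((n : ℝ) + 1) * z ^ ((1 - c) / 2)) * Real.exp (-(μ * t)) ^ n :=
        mul_le_mul h1 h2 h3 hA0
    _ = _ := by ring

/-- **Pointwise envelope of `Y`**: `|Y(z, t)| ≤ A_t z^{(1-c)/2}` on `(0, 1]`. [folklore] -/
theorem exists_abs_initHeat_le {t : ℝ} (ht : 0 < t) :
    ∃ C : ℝ, 0 ≤ C ∧ ∀ z ∈ Ioc (0 : ℝ) 1, |initHeat c μ z t| ≤ C * z ^ ((1 - c) / 2) := by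
  obtain ⟨A, hA0, hA⟩ := exists_envelope hc hc2
  have hS := summable_heat_bound hμ ht A 1
  refine ⟨∑' n : ℕ, A * ((n : ℝ) + 1) ^ 1 * Real.exp (-(μ * t)) ^ n,
    tsum_nonneg fun n => by positivity, fun z hz => ?_⟩
  have hb : ∀ n, |jacobiHeatTerm c μ (jacobiInitCoeff c) n z t| ≤
      (A * ((n : ℝ) + 1) ^ 1 * Real.exp (-(μ * t)) ^ n) * z ^ ((1 - c) / 2) := fun n => by
    rw [pow_one]; exact abs_term_le_envelope hμ hA n hz ht
  have hsum : Summable fun n => jacobiHeatTerm c μ (jacobiInitCoeff c) n z t :=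
    Summable.of_norm_bounded (hS.mul_right _) fun n => by rw [Real.norm_eq_abs]; exact hb n
  unfold initHeat jacobiHeat
  calc |∑' n, jacobiHeatTerm c μ (jacobiInitCoeff c) n z t|
        ≤ ∑' n, |jacobiHeatTerm c μ (jacobiInitCoeff c) n z t| := by
          have := norm_tsum_le_tsum_norm hsum.norm
          simpa only [Real.norm_eq_abs] using this
    _ ≤ ∑' n : ℕ, (A * ((n : ℝ) + 1) ^ 1 * Real.exp (-(μ * t)) ^ n) * z ^ ((1 - c) / 2) :=
          hsum.abs.tsum_le_tsum hb (hS.mul_right _)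
    _ = _ := by rw [tsum_mul_right]

omit hμ in
/-- `z^{(c-1)/2} (1-z)^{1-c}`-type products: `ρ(z) z^{(1-c)/2} g(z)` is integrable on `[0,1]` for
continuous `g`. [folklore] -/
theorem intervalIntegrable_weight_envelope {g : ℝ → ℝ} (hg : Continuous g) :
    IntervalIntegrable (fun z => jacobiWeight c z * z ^ ((1 - c) / 2) * g z) volume 0 1 := by
  have h : IntervalIntegrable (fun z : ℝ => (1 - z) ^ (1 - c) * (z ^ ((c - 1) / 2) * g z))
      volume 0 1 :=
    (intervalIntegrable_one_sub_rpow hc2).mul_continuousOn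
      ((Real.continuous_rpow_const (by linarith)).mul hg).continuousOn
  refine h.congr fun z hz => ?_
  rw [uIoc_of_le zero_le_one] at hz
  show (1 - z) ^ (1 - c) * (z ^ ((c - 1) / 2) * g z) = jacobiWeight c z * z ^ ((1 - c) / 2) * g z
  rw [jacobiWeight, show z ^ (c - 1) * (1 - z) ^ (1 - c) * z ^ ((1 - c) / 2) * g z
    = (z ^ (c - 1) * z ^ ((1 - c) / 2)) * ((1 - z) ^ (1 - c) * g z) by ring,
    ← Real.rpow_add hz.1, show c - 1 + (1 - c) / 2 = (c - 1) / 2 by ring]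
  ring

/-- `ρ Y(·,t) g` is integrable on `[0,1]` for continuous `g` (`t > 0`). [folklore] -/
theorem intervalIntegrable_weight_initHeat_mul {t : ℝ} (ht : 0 < t) {g : ℝ → ℝ} (hg : Continuous g) :
    IntervalIntegrable (fun z => jacobiWeight c z * initHeat c μ z t * g z) volume 0 1 := by
  obtain ⟨C, hC0, hC⟩ := exists_abs_initHeat_le hc hc2 hμ ht
  have hY : ContinuousOn (fun z => initHeat c μ z t) (Ioc 0 1) :=
    (continuousOn_jacobiHeat' hc hc2 hμ (init_hγ hc hc2)).comp
      (Continuous.prodMk_left t).continuousOn fun z hz => ⟨hz, ht⟩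
  refine (intervalIntegrable_weight_envelope hc hc2 (g := fun z => C * |g z|)
    (continuous_const.mul hg.abs)).mono_fun' ?_ ?_
  · rw [uIoc_of_le zero_le_one]
    exact ((measurable_jacobiWeight c).aestronglyMeasurable.mul
      (hY.aestronglyMeasurable measurableSet_Ioc)).mul hg.aestronglyMeasurable
  · rw [uIoc_of_le zero_le_one]
    refine (ae_restrict_mem measurableSet_Ioc).mono fun z hz => ?_
    dsimp only
    rw [Real.norm_eq_abs, abs_mul, abs_mul, abs_of_nonneg (jacobiWeight_nonneg c ⟨hz.1.le, hz.2⟩)]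
    have := hC z hz
    have hρ := jacobiWeight_nonneg c ⟨hz.1.le, hz.2⟩
    calc jacobiWeight c z * |initHeat c μ z t| * |g z|
          ≤ jacobiWeight c z * (C * z ^ ((1 - c) / 2)) * |g z| := by gcongr
      _ = jacobiWeight c z * z ^ ((1 - c) / 2) * (C * |g z|) := by ring

/-- **Termwise integration** (dominated convergence): for a polynomial `p` and `t > 0`,
`Σ_n γ_n e^{-μ_n t} ∫₀¹ ρ y_n p = ∫₀¹ ρ Y(·,t) p`. [folklore] -/
theorem hasSum_integral_initHeat {t : ℝ} (ht : 0 < t) (p : ℝ[X]) :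
    HasSum (fun n => jacobiInitCoeff c n * Real.exp (-(μ * n * (n + 1) * t)) *
        ∫ z in (0 : ℝ)..1, jacobiWeight c z * ((hypJacobi c n).eval z * p.eval z))
      (∫ z in (0 : ℝ)..1, jacobiWeight c z * initHeat c μ z t * p.eval z) := by
  obtain ⟨A, hA0, hA⟩ := exists_envelope hc hc2
  have hpc := (Polynomial.differentiable (𝕜 := ℝ) p).continuous
  have hS := summable_heat_bound hμ ht A 1
  have hIoc : Set.uIoc (0 : ℝ) 1 = Ioc 0 1 := uIoc_of_le zero_le_one
  have key := intervalIntegral.hasSum_integral_of_dominated_convergence (μ := volume) (a := 0)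
    (b := 1) (F := fun n z => jacobiWeight c z * jacobiHeatTerm c μ (jacobiInitCoeff c) n z t * p.eval z)
    (f := fun z => jacobiWeight c z * initHeat c μ z t * p.eval z)
    (fun n z => (A * ((n : ℝ) + 1) ^ 1 * Real.exp (-(μ * t)) ^ n) *
      (jacobiWeight c z * z ^ ((1 - c) / 2) * |p.eval z|)) ?_ ?_ ?_ ?_ ?_
  · -- identify the terms: `∫ ρ term_n p = γ_n e ∫ ρ y_n p`
    refine key.congr_fun fun n => ?_
    -- note `HasSum.congr_fun` wants equality of the two term functions
    rw [← intervalIntegral.integral_const_mul]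
    refine intervalIntegral.integral_congr fun z _ => ?_
    simp only [jacobiHeatTerm]; ring
  · intro n
    have hterm : Continuous fun z => jacobiHeatTerm c μ (jacobiInitCoeff c) n z t :=
      continuous_const.mul (continuous_hypJacobi_eval c n)
    exact (((measurable_jacobiWeight c).mul hterm.measurable).mul hpc.measurable).aestronglyMeasurable
  · intro n
    refine ae_of_all _ fun z hz => ?_
    rw [hIoc] at hz
    rw [Real.norm_eq_abs, abs_mul, abs_mul, abs_of_nonneg (jacobiWeight_nonneg c ⟨hz.1.le, hz.2⟩)]
    have h := abs_term_le_envelope hμ hA n hz ht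
    have hρ := jacobiWeight_nonneg c ⟨hz.1.le, hz.2⟩
    calc jacobiWeight c z * |jacobiHeatTerm c μ (jacobiInitCoeff c) n z t| * |p.eval z|
          ≤ jacobiWeight c z * (A * ((n : ℝ) + 1) * Real.exp (-(μ * t)) ^ n * z ^ ((1 - c) / 2))
            * |p.eval z| := by gcongr
      _ = _ := by ring
  · refine ae_of_all _ fun z _ => (hS.mul_right _)
  · refine (intervalIntegrable_weight_envelope hc hc2 (g := fun z =>
      (∑' n : ℕ, A * ((n : ℝ) + 1) ^ 1 * Real.exp (-(μ * t)) ^ n) * |p.eval z|)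
      (continuous_const.mul hpc.abs)).congr fun z _ => ?_
    show jacobiWeight c z * z ^ ((1 - c) / 2) *
        ((∑' n : ℕ, A * ((n : ℝ) + 1) ^ 1 * Real.exp (-(μ * t)) ^ n) * |p.eval z|)
      = ∑' n : ℕ, A * ((n : ℝ) + 1) ^ 1 * Real.exp (-(μ * t)) ^ n
        * (jacobiWeight c z * z ^ ((1 - c) / 2) * |p.eval z|)
    rw [tsum_mul_right]; ring
  · refine ae_of_all _ fun z hz => ?_
    rw [hIoc] at hz
    have hsum := summable_jacobiHeatTerm hc hc2 hμ (init_hγ hc hc2) hz ht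
    have := (hsum.hasSum.mul_left (jacobiWeight c z)).mul_right (p.eval z)
    simpa only [initHeat, jacobiHeat] using this

/-- **Orthogonality collapses the sum**: for `p = Σ_{m<N} b_m y_m`,
`∫₀¹ ρ Y(·,t) p = Σ_{n<N} γ_n e^{-μ_n t} b_n h_n`. [folklore] -/
theorem integral_initHeat_mul_sum {t : ℝ} (ht : 0 < t) (b : ℕ → ℝ) (N : ℕ) :
    ∫ z in (0 : ℝ)..1, jacobiWeight c z * initHeat c μ z t * jacobiHeatFin c μ b N z 0
      = ∑ n ∈ Finset.range N, jacobiInitCoeff c n * Real.exp (-(μ * n * (n + 1) * t))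
          * (b n * hypJacobiNormSq c n) := by
  set p : ℝ[X] := ∑ m ∈ Finset.range N, b m • hypJacobi c m with hp
  have hpe : ∀ z, p.eval z = jacobiHeatFin c μ b N z 0 := fun z => by
    simp [hp, jacobiHeatFin, eval_finsetSum, eval_smul, smul_eq_mul]
  have hsum := hasSum_integral_initHeat hc hc2 hμ ht p
  -- the inner integrals: `∫ ρ y_n p = b_n h_n` for `n < N`, `0` otherwise
  have hinner : ∀ n, ∫ z in (0 : ℝ)..1, jacobiWeight c z * ((hypJacobi c n).eval z * p.eval z)
      = if n < N then b n * hypJacobiNormSq c n else 0 := by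
    intro n
    have hqc := continuous_hypJacobi_eval c n
    have e : ∀ z, jacobiWeight c z * ((hypJacobi c n).eval z * p.eval z)
        = ∑ m ∈ Finset.range N, b m * (jacobiWeight c z *
          ((hypJacobi c n).eval z * (hypJacobi c m).eval z)) := fun z => by
      rw [hpe z, jacobiHeatFin, Finset.mul_sum, Finset.mul_sum]
      refine Finset.sum_congr rfl fun m _ => ?_
      simp only [mul_zero, neg_zero, Real.exp_zero, mul_one]; ring
    simp_rw [e]
    rw [intervalIntegral.integral_finsetSum]
    · simp_rw [intervalIntegral.integral_const_mul]
      split_ifs with hn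
      · rw [Finset.sum_eq_single n]
        · rw [hypJacobiNormSq]
          congr 1
          exact intervalIntegral.integral_congr fun z _ => by ring
        · intro m _ hmn
          rw [integral_jacobiWeight_hypJacobi_mul_hypJacobi hc hc2 (Ne.symm hmn), mul_zero]
        · intro h; exact absurd (Finset.mem_range.2 hn) h
      · refine Finset.sum_eq_zero fun m hm => ?_
        have hmn : n ≠ m := fun h => hn (h ▸ Finset.mem_range.1 hm)
        rw [integral_jacobiWeight_hypJacobi_mul_hypJacobi hc hc2 hmn, mul_zero]
    · intro m _
      exact (intervalIntegrable_jacobiWeight_mul hc.le hc2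
        (hqc.mul (continuous_hypJacobi_eval c m))).const_mul _
  simp_rw [hinner] at hsum
  have hfin : HasSum (fun n : ℕ => jacobiInitCoeff c n * Real.exp (-(μ * n * (n + 1) * t))
      * (if n < N then b n * hypJacobiNormSq c n else 0))
      (∑ n ∈ Finset.range N, jacobiInitCoeff c n * Real.exp (-(μ * n * (n + 1) * t))
        * (if n < N then b n * hypJacobiNormSq c n else 0)) :=
    hasSum_sum_of_ne_finset_zero fun n hn => by
      rw [if_neg (fun h => hn (Finset.mem_range.2 h)), mul_zero]
  have heq := hsum.unique hfin
  rw [show (fun z => jacobiWeight c z * initHeat c μ z t * jacobiHeatFin c μ b N z 0)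
      = fun z => jacobiWeight c z * initHeat c μ z t * p.eval z from funext fun z => by rw [hpe] ]
  rw [heq]
  exact Finset.sum_congr rfl fun n hn => by rw [if_pos (Finset.mem_range.1 hn)]

/-- **Duality**: `∫₀¹ ρ Y(·,t) V_b(·,0) = ∫₀¹ (1-z)^{1-c} V_b(·,t)` (`= weightedIntegral c μ b N t`).
[folklore] -/
theorem integral_initHeat_duality {t : ℝ} (ht : 0 < t) (b : ℕ → ℝ) (N : ℕ) :
    ∫ z in (0 : ℝ)..1, jacobiWeight c z * initHeat c μ z t * jacobiHeatFin c μ b N z 0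
      = weightedIntegral c μ b N t := by
  rw [integral_initHeat_mul_sum hc hc2 hμ ht b N, weightedIntegral]
  have e : ∀ z, (1 - z) ^ (1 - c) * jacobiHeatFin c μ b N z t
      = ∑ n ∈ Finset.range N, b n * Real.exp (-(μ * n * (n + 1) * t))
          * ((1 - z) ^ (1 - c) * (hypJacobi c n).eval z) := fun z => by
    rw [jacobiHeatFin, Finset.mul_sum]
    exact Finset.sum_congr rfl fun n _ => by ring
  simp_rw [e]
  rw [intervalIntegral.integral_finsetSum]
  · refine Finset.sum_congr rfl fun n _ => ?_
    rw [intervalIntegral.integral_const_mul, ← jacobiInitCoeff_mul_normSq hc hc2 n]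
    ring
  · intro n _
    exact ((intervalIntegrable_one_sub_rpow hc2).mul_continuousOn
      (continuous_hypJacobi_eval c n).continuousOn).const_mul _

omit hμ in
/-- `∫₀¹ ρ V_b(·, s) = b_0 h_0` — only the `y_0 = 1` component has mass (for `N > 0`; `0` if
`N = 0`). [folklore] -/
theorem integral_weight_mul_jacobiHeatFin (b : ℕ → ℝ) (N : ℕ) (s : ℝ) :
    ∫ z in (0 : ℝ)..1, jacobiWeight c z * jacobiHeatFin c μ b N z s
      = if 0 < N then b 0 * hypJacobiNormSq c 0 else 0 := by
  have e : ∀ z, jacobiWeight c z * jacobiHeatFin c μ b N z s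
      = ∑ n ∈ Finset.range N, b n * Real.exp (-(μ * n * (n + 1) * s))
          * (jacobiWeight c z * ((hypJacobi c 0).eval z * (hypJacobi c n).eval z)) := fun z => by
    rw [jacobiHeatFin, Finset.mul_sum]
    exact Finset.sum_congr rfl fun n _ => by rw [hypJacobi_zero_eval]; ring
  simp_rw [e]
  rw [intervalIntegral.integral_finsetSum]
  · simp_rw [intervalIntegral.integral_const_mul]
    split_ifs with hN
    · rw [Finset.sum_eq_single 0]
      · simp only [Nat.cast_zero, mul_zero, zero_mul, neg_zero, Real.exp_zero, mul_one,
          hypJacobiNormSq]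
        congr 1
        exact intervalIntegral.integral_congr fun z _ => by rw [hypJacobi_zero_eval]; ring
      · intro m _ hm0
        rw [integral_jacobiWeight_hypJacobi_mul_hypJacobi hc hc2 (Ne.symm hm0), mul_zero]
      · intro h; exact absurd (Finset.mem_range.2 hN) h
    · have : N = 0 := by omega
      subst this; simp
  · intro n _
    exact (intervalIntegrable_jacobiWeight_mul hc.le hc2
      ((continuous_hypJacobi_eval c 0).mul (continuous_hypJacobi_eval c n))).const_mul _

end Duality

/-! ### The order properties -/

section Order

variable {c μ : ℝ} (hc : 1 < c) (hc2 : c < 2) (hμ : 0 < μ)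
include hc hc2 hμ

/-- `Y(·, t)` is continuous on `(0, 1]` (`t > 0`). [folklore] -/
theorem continuousOn_initHeat {t : ℝ} (ht : 0 < t) :
    ContinuousOn (fun z => initHeat c μ z t) (Ioc 0 1) :=
  (continuousOn_jacobiHeat' hc hc2 hμ (init_hγ hc hc2)).comp
    (Continuous.prodMk_left t).continuousOn fun _ hz => ⟨hz, ht⟩

omit hμ in
/-- The generic step: if `F` is continuous on `(0, 1]`, `ρ F` integrable on `[0, 1]`, and
`∫₀¹ ρ F · V_b(·,0) ≥ 0` for every polynomial datum `b` with `V_b(·,0) = r²`, then `F ≥ 0` on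
`(0, 1]`. [folklore] -/
theorem nonneg_on_Ioc_of_duality {F : ℝ → ℝ} (hF : ContinuousOn F (Ioc 0 1))
    (hint : IntervalIntegrable (fun z => jacobiWeight c z * F z) volume 0 1)
    (hpos : ∀ (b : ℕ → ℝ) (N : ℕ), (∀ z, 0 ≤ jacobiHeatFin c μ b N z 0) →
      0 ≤ ∫ z in (0 : ℝ)..1, jacobiWeight c z * F z * jacobiHeatFin c μ b N z 0)
    {z : ℝ} (hz : z ∈ Ioc (0 : ℝ) 1) : 0 ≤ F z := by
  have hck : ∀ k : ℕ, (k : ℝ) + c ≠ 0 := fun k => by positivity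
  -- on the open interval
  have hopen : ∀ y ∈ Ioo (0 : ℝ) 1, 0 ≤ F y := by
    intro y hy
    refine nonneg_of_forall_integral_mul_sq_nonneg hc hc2 (hF.mono Ioo_subset_Ioc_self) hint
      (fun r => ?_) hy
    obtain ⟨d, b, hb⟩ := exists_eval_eq_sum_hypJacobi hck (r * r)
    have hV : ∀ z, jacobiHeatFin c μ b (d + 1) z 0 = (r.eval z) ^ 2 := fun z => by
      rw [sq, ← eval_mul, hb z, jacobiHeatFin]
      refine Finset.sum_congr rfl fun n _ => ?_
      simp
    have := hpos b (d + 1) fun z => by rw [hV]; exact sq_nonneg _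
    simpa only [hV] using this
  -- at `z = 1` by continuity from inside
  rcases hz.2.lt_or_eq with hlt | heq
  · exact hopen z ⟨hz.1, hlt⟩
  · subst heq
    haveI : (𝓝[Ioo (0 : ℝ) 1] (1 : ℝ)).NeBot := by
      refine mem_closure_iff_nhdsWithin_neBot.1 ?_
      rw [closure_Ioo zero_ne_one]; exact ⟨zero_le_one, le_rfl⟩
    have htend : Tendsto F (𝓝[Ioo 0 1] 1) (𝓝 (F 1)) :=
      ((hF 1 ⟨zero_lt_one, le_rfl⟩).mono Ioo_subset_Ioc_self).tendsto
    exact ge_of_tendsto htend (eventually_nhdsWithin_of_forall hopen)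

/-- **`Y ≥ 1`**: `1 ≤ Y(z, t)` for `t > 0`, `z ∈ (0, 1]` (the initial datum `z^{1-c} ≥ 1 = y_0` and
positivity preservation, by duality). [folklore] -/
theorem one_le_initHeat {t : ℝ} (ht : 0 < t) {z : ℝ} (hz : z ∈ Ioc (0 : ℝ) 1) :
    1 ≤ initHeat c μ z t := by
  have h := nonneg_on_Ioc_of_duality (μ := μ) hc hc2 (F := fun z => initHeat c μ z t - 1)
    ((continuousOn_initHeat hc hc2 hμ ht).sub continuousOn_const) ?_ ?_ hz
  · linarith
  · have h1 := intervalIntegrable_weight_initHeat_mul hc hc2 hμ ht continuous_const (g := fun _ => 1)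
    have h2 := intervalIntegrable_jacobiWeight hc.le hc2
    refine (h1.sub h2).congr fun z _ => ?_
    show jacobiWeight c z * initHeat c μ z t * 1 - jacobiWeight c z = _
    ring
  · intro b N hb
    -- `∫ ρ (Y - 1) V_b(0) = W_b(t) - ∫ ρ V_b(t) = ∫ ρ (z^{1-c} - 1) V_b(t) ≥ 0`
    have hVc0 : Continuous fun z => jacobiHeatFin c μ b N z 0 :=
      (continuous_jacobiHeatFin c μ b N).comp (Continuous.prodMk_left 0)
    have hVct : Continuous fun z => jacobiHeatFin c μ b N z t :=
      (continuous_jacobiHeatFin c μ b N).comp (Continuous.prodMk_left t)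
    have hi1 := intervalIntegrable_weight_initHeat_mul hc hc2 hμ ht hVc0
    have hi2 := intervalIntegrable_jacobiWeight_mul hc.le hc2 hVc0
    have hsplit : ∫ z in (0 : ℝ)..1, jacobiWeight c z * (initHeat c μ z t - 1) * jacobiHeatFin c μ b N z 0
        = (∫ z in (0 : ℝ)..1, jacobiWeight c z * initHeat c μ z t * jacobiHeatFin c μ b N z 0)
          - ∫ z in (0 : ℝ)..1, jacobiWeight c z * jacobiHeatFin c μ b N z 0 := by
      rw [← intervalIntegral.integral_sub hi1 hi2]
      exact intervalIntegral.integral_congr fun z _ => by ring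
    rw [hsplit, integral_initHeat_duality hc hc2 hμ ht, integral_weight_mul_jacobiHeatFin hc hc2 b N 0,
      ← integral_weight_mul_jacobiHeatFin hc hc2 b N t, weightedIntegral,
      ← intervalIntegral.integral_sub ((intervalIntegrable_one_sub_rpow hc2).mul_continuousOn
        hVct.continuousOn) (intervalIntegrable_jacobiWeight_mul hc.le hc2 hVct)]
    refine intervalIntegral.integral_nonneg zero_le_one fun z hz => ?_
    have hV : 0 ≤ jacobiHeatFin c μ b N z t :=
      jacobiHeatFin_nonneg hc hc2 b N hμ.le (fun z _ => hb z) ht.le hz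
    have hle : jacobiWeight c z ≤ (1 - z) ^ (1 - c) := jacobiWeight_le hc hc2 hz
    nlinarith

/-- **Sub-Markov for `Y`**: `e^{-λ₀ t} Y(z, t) ≤ z^{1-c}` for `t > 0`, `z ∈ (0, 1]`
(`λ₀ = μ(c-1)(2-c)`). [folklore] -/
theorem exp_mul_initHeat_le {t : ℝ} (ht : 0 < t) {z : ℝ} (hz : z ∈ Ioc (0 : ℝ) 1) :
    Real.exp (-(μ * (c - 1) * (2 - c) * t)) * initHeat c μ z t ≤ z ^ (1 - c) := by
  set E := Real.exp (-(μ * (c - 1) * (2 - c) * t)) with hE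
  have h := nonneg_on_Ioc_of_duality (μ := μ) hc hc2 (F := fun z => z ^ (1 - c) - E * initHeat c μ z t)
    ?_ ?_ ?_ hz
  · linarith
  · refine ContinuousOn.sub (fun z hz => ?_) (continuousOn_const.mul (continuousOn_initHeat hc hc2 hμ ht))
    exact (continuousAt_id.rpow_const (Or.inl hz.1.ne')).continuousWithinAt
  · have h1 := intervalIntegrable_weight_initHeat_mul hc hc2 hμ ht continuous_const (g := fun _ => E)
    have h2 := intervalIntegrable_one_sub_rpow hc2
    refine (h2.sub h1).congr fun z hz => ?_
    rw [uIoc_of_le zero_le_one] at hz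
    show (1 - z) ^ (1 - c) - jacobiWeight c z * initHeat c μ z t * E = _
    rw [jacobiWeight, mul_sub, show z ^ (c - 1) * (1 - z) ^ (1 - c) * z ^ (1 - c)
      = (z ^ (c - 1) * z ^ (1 - c)) * (1 - z) ^ (1 - c) by ring, ← Real.rpow_add hz.1,
      show c - 1 + (1 - c) = 0 by ring, Real.rpow_zero, one_mul]
    ring
  · intro b N hb
    have hVc0 : Continuous fun z => jacobiHeatFin c μ b N z 0 :=
      (continuous_jacobiHeatFin c μ b N).comp (Continuous.prodMk_left 0)
    have hi1 := intervalIntegrable_weight_initHeat_mul hc hc2 hμ ht hVc0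
    have hi0 : IntervalIntegrable (fun z => jacobiWeight c z * z ^ (1 - c) * jacobiHeatFin c μ b N z 0)
        volume 0 1 := by
      refine ((intervalIntegrable_one_sub_rpow hc2).mul_continuousOn hVc0.continuousOn).congr
        fun z hz => ?_
      rw [uIoc_of_le zero_le_one] at hz
      show (1 - z) ^ (1 - c) * jacobiHeatFin c μ b N z 0 = _
      rw [jacobiWeight, show z ^ (c - 1) * (1 - z) ^ (1 - c) * z ^ (1 - c)
        = (z ^ (c - 1) * z ^ (1 - c)) * (1 - z) ^ (1 - c) by ring, ← Real.rpow_add hz.1,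
        show c - 1 + (1 - c) = 0 by ring, Real.rpow_zero, one_mul]
    have hsplit : ∫ z in (0 : ℝ)..1, jacobiWeight c z * (z ^ (1 - c) - E * initHeat c μ z t)
          * jacobiHeatFin c μ b N z 0
        = (∫ z in (0 : ℝ)..1, jacobiWeight c z * z ^ (1 - c) * jacobiHeatFin c μ b N z 0)
          - E * ∫ z in (0 : ℝ)..1, jacobiWeight c z * initHeat c μ z t * jacobiHeatFin c μ b N z 0 := by
      rw [← intervalIntegral.integral_const_mul, ← intervalIntegral.integral_sub hi0 (hi1.const_mul _)]
      exact intervalIntegral.integral_congr fun z _ => by ring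
    have hW0 : ∫ z in (0 : ℝ)..1, jacobiWeight c z * z ^ (1 - c) * jacobiHeatFin c μ b N z 0
        = weightedIntegral c μ b N 0 := by
      rw [weightedIntegral]
      refine intervalIntegral.integral_congr_ae (ae_of_all _ fun z hz => ?_)
      rw [uIoc_of_le zero_le_one] at hz
      rw [jacobiWeight, show z ^ (c - 1) * (1 - z) ^ (1 - c) * z ^ (1 - c)
        = (z ^ (c - 1) * z ^ (1 - c)) * (1 - z) ^ (1 - c) by ring, ← Real.rpow_add hz.1,
        show c - 1 + (1 - c) = 0 by ring, Real.rpow_zero, one_mul]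
    rw [hsplit, hW0, integral_initHeat_duality hc hc2 hμ ht]
    have := exp_mul_weightedIntegral_le hc hc2 b N hμ (fun z _ => hb z) ht.le
    rw [← hE] at this
    linarith

/-- **Monotonicity**: `t ↦ e^{-λ₀ t} Y(z, t)` is non-increasing on `(0, ∞)` for `z ∈ (0, 1]`.
[folklore] -/
theorem exp_mul_initHeat_antitone {t₁ t₂ : ℝ} (ht₁ : 0 < t₁) (h12 : t₁ ≤ t₂) {z : ℝ}
    (hz : z ∈ Ioc (0 : ℝ) 1) :
    Real.exp (-(μ * (c - 1) * (2 - c) * t₂)) * initHeat c μ z t₂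
      ≤ Real.exp (-(μ * (c - 1) * (2 - c) * t₁)) * initHeat c μ z t₁ := by
  have ht₂ : 0 < t₂ := ht₁.trans_le h12
  set E₁ := Real.exp (-(μ * (c - 1) * (2 - c) * t₁)) with hE₁
  set E₂ := Real.exp (-(μ * (c - 1) * (2 - c) * t₂)) with hE₂
  have h := nonneg_on_Ioc_of_duality (μ := μ) hc hc2
    (F := fun z => E₁ * initHeat c μ z t₁ - E₂ * initHeat c μ z t₂)
    ((continuousOn_const.mul (continuousOn_initHeat hc hc2 hμ ht₁)).sub
      (continuousOn_const.mul (continuousOn_initHeat hc hc2 hμ ht₂))) ?_ ?_ hz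
  · linarith
  · have h1 := intervalIntegrable_weight_initHeat_mul hc hc2 hμ ht₁ continuous_const (g := fun _ => E₁)
    have h2 := intervalIntegrable_weight_initHeat_mul hc hc2 hμ ht₂ continuous_const (g := fun _ => E₂)
    refine (h1.sub h2).congr fun z _ => ?_
    show jacobiWeight c z * initHeat c μ z t₁ * E₁ - jacobiWeight c z * initHeat c μ z t₂ * E₂ = _
    ring
  · intro b N hb
    have hVc0 : Continuous fun z => jacobiHeatFin c μ b N z 0 :=
      (continuous_jacobiHeatFin c μ b N).comp (Continuous.prodMk_left 0)
    have hi1 := intervalIntegrable_weight_initHeat_mul hc hc2 hμ ht₁ hVc0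
    have hi2 := intervalIntegrable_weight_initHeat_mul hc hc2 hμ ht₂ hVc0
    have hsplit : ∫ z in (0 : ℝ)..1, jacobiWeight c z * (E₁ * initHeat c μ z t₁ - E₂ * initHeat c μ z t₂)
          * jacobiHeatFin c μ b N z 0
        = E₁ * (∫ z in (0 : ℝ)..1, jacobiWeight c z * initHeat c μ z t₁ * jacobiHeatFin c μ b N z 0)
          - E₂ * ∫ z in (0 : ℝ)..1, jacobiWeight c z * initHeat c μ z t₂ * jacobiHeatFin c μ b N z 0 := by
      rw [← intervalIntegral.integral_const_mul, ← intervalIntegral.integral_const_mul,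
        ← intervalIntegral.integral_sub (hi1.const_mul _) (hi2.const_mul _)]
      exact intervalIntegral.integral_congr fun z _ => by ring
    rw [hsplit, integral_initHeat_duality hc hc2 hμ ht₁, integral_initHeat_duality hc hc2 hμ ht₂]
    -- semigroup: `V_b(·, t₁ + s) = V_{b'}(·, s)` with `b' n = b n e^{-μ_n t₁}`
    set b' : ℕ → ℝ := fun n => b n * Real.exp (-(μ * n * (n + 1) * t₁)) with hb'
    have hsemi : ∀ z s, jacobiHeatFin c μ b N z (t₁ + s) = jacobiHeatFin c μ b' N z s := by
      intro z s
      unfold jacobiHeatFin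
      refine Finset.sum_congr rfl fun n _ => ?_
      rw [hb', show -(μ * n * (n + 1) * (t₁ + s)) = -(μ * n * (n + 1) * t₁) + -(μ * n * (n + 1) * s)
        by ring, Real.exp_add]
      ring
    have hW : ∀ s, weightedIntegral c μ b N (t₁ + s) = weightedIntegral c μ b' N s := fun s => by
      unfold weightedIntegral; simp_rw [hsemi]
    have hb'0 : ∀ z ∈ Icc (0 : ℝ) 1, 0 ≤ jacobiHeatFin c μ b' N z 0 := fun z hz => by
      rw [← hsemi, add_zero]
      exact jacobiHeatFin_nonneg hc hc2 b N hμ.le (fun z _ => hb z) ht₁.le hz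
    have hsub := exp_mul_weightedIntegral_le hc hc2 b' N hμ hb'0 (sub_nonneg.2 h12)
    rw [← hW, add_sub_cancel, show weightedIntegral c μ b' N 0 = weightedIntegral c μ b N t₁ by
      rw [← hW 0, add_zero] ] at hsub
    -- `E₂ = E₁ * e^{-λ₀ (t₂ - t₁)}`
    have hE : E₂ = E₁ * Real.exp (-(μ * (c - 1) * (2 - c) * (t₂ - t₁))) := by
      rw [hE₁, hE₂, ← Real.exp_add]; ring_nf
    rw [hE, mul_assoc]
    have hE₁0 : 0 ≤ E₁ := (Real.exp_pos _).le
    nlinarith [mul_le_mul_of_nonneg_left hsub hE₁0]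

end Order

end Literature.Analysis.SpecialFunctions
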